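/-
Origin: expansion seat `prover-pub-hodgecm-mc-binder-2-g11-0`, handover #37 2026-08-20T02:20Z md5 83d65228aa94 (345 l.; CERTIFIED rc 0 / 0 warn / 45.9 s; imports #35 + RUN-37 #22 `SideW` + unitary-1 RUN-37 `Model/WmInputInstance`; abbrevs `pinTorusChar V S hGR hW` (χ_T of the pin `(frameD V, dW S)`, the other three sign facts READ OFF `HermSpace3`/`signs_fin_two`), `archOf … t := placesEquiv⁻¹ (placesCoord t)`; `pair_cmAdelicEquiv_jT₁₂_toAdeles` (E's chart pair = `archProdHom (1, archDiag (dW S) u)`, #25); VALUE currency **`cmPairRepTwist_jT₁₂_ins_vacuum`** / `_ins_smul_vacuum`; AT THE W PIN OF RECORD `wmInputCM₂g` under the sign fact `hW`: **`omgW_ins_vacuum_wmInputCM₂g`** (`ω(ι_T t)(ins f φ₀) = (η(archProdHom(1,archDiag u_t))·χ_T(u_t)·∏_{ι₁} d(u_t)) • ins f φ₀`), **`omgW_ins_vacuum_eq_of_weight`** and **`omgW_ins_smul_vacuum_eq_of_weight`** = the census field `omg_ins` AT `φ₀` (and at every `a • φ₀`, model1's variant) from ONE scalar identity `hμ : ∀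 t, η(…)·χ_T(u_t)·∏ d(u_t) = (printPlacesW t)⁻¹` ((J-μ)/(R3), glue-1's S-side read-off); proof = `dsimp only [omgW]; rw [wmInputCM₂g_ρ_eq_of … hW, printedTorusHom_apply]; exact` the value lemma; NAME LIST `HodgeCM.Model.HypCensus.omgW_ins_vacuum_wmInputCM₂g`, `HodgeCM.Model.HypCensus.omgW_ins_vacuum_eq_of_weight`, `HodgeCM.Model.HypCensus.omgW_ins_smul_vacuum_eq_of_weight`; axioms trio) (`HOME/mc/pub-hodgecm-mc-binder-2/g11/pkg/HodgeCM/Model/HypCensus/OmgInsPin.lean`, md5 83d65228aa94, 345 lines);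
landed by the gen-14 packager (p-g14) in gate run 39 as `HodgeCM/Model/HypCensus/OmgInsPin.lean` (verbatim).
-/
/-
Origin: speedrun cell pub-hodgecm, MODEL-CONSTRUCTION sub-cell, lineage mc-binder-2 (BINDER-OWNERS rows 18/19: E binders
`hyp12` / `hyp34` of `Model.perL_picardCM_r15A`), seat prover-pub-hodgecm-mc-binder-2-g11-0 (gen 11), 2026-08-20.
Target in PKG: `HodgeCM/Model/HypCensus/OmgInsPin.lean` (NEW additive leaf; imports this lineage's `HypCensus/OmgInsVacuum` (gen 11),
`HypCensus/SideW` (#22) and mc-unitary-1's `Model/WmInputInstance` (RUN 37, the W pin `wmInputCM₂g`)).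
KERNEL ONLY: 0 records, nothing cited as hypothesis, 0 `def … : Prop`; theorems only.
-/
import Summits.HodgeConjecture.HodgeCM.Model.HypCensus.OmgInsVacuum
import Summits.HodgeConjecture.HodgeCM.Model.HypCensus.SideW
import Summits.HodgeConjecture.HodgeCM.Model.WmInputInstance

/-!
# Census kit (rows A12/A34): the field `omg_ins` AT THE PRINTED VACUUM, at the W pin of record `wmInputCM₂g`

`HypCensus/SideW` (#22) states `omg_ins : ω(ι_T t)(ins f φ) = ins f (ω_T t φ)`; E uses it at the printed vacuum `φ₀` only
(`ArchCOrbit.covariant`; binder-2-g11 memo (T12)-ORIENTATION).  On the W pin of record (`W₀ := wmInputCM₂g V S hGR η hη hηc τ T hT`,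
`W₀.eW = cmAdelicEquiv`, `W₀.ρ = ρ_η.toHomUnits` under the sign fact `hW`) the chart point is the archimedean torus element
(#25 `cmAdelicEquiv_jT₁₂_toAdeles`), so `OmgInsVacuum.cmPairRepTwist_torus_ins_vacuum` computes the left side:

* **`omgW_ins_vacuum_wmInputCM₂g`**: `ω(ι_T t)(ins f φ₀) = (η(1,(diag u_t)_𝔸) · χ_T(u_t) · ∏_{ι₁} d(u_t)) • ins f φ₀`,
  `u_t = placesEquiv⁻¹ (placesCoord t)`;
* **`omgW_ins_vacuum_eq_of_weight`**: the census field `omg_ins` AT `φ₀` follows from ONE scalar identity on `T(L⁺ ⊗ ℝ)`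
  ((J-μ)/(R3), glue-1's S-side read-off): `η(1,(diag u_t)_𝔸) · χ_T(u_t) · ∏ d(u_t) = (w t)⁻¹`, `w = printPlacesW` the printed weight.

Nothing here is a claim of PerL/QW8.  Style lint (L-notation): no `local notation`.
-/

set_option autoImplicit false

noncomputable section

open Filter Topology
open NumberField NumberField.InfinitePlace
open scoped TensorProduct Classical
open MvPolynomial
open Literature.NumberTheory.Automorphic Literature.NumberTheory.Automorphic.UnitaryGroup Literature.NumberTheory.Weil1964
open Literature.RepresentationTheory.KonnoKonno2007 Literature.RepresentationTheory.KonnoKonno2007.RealDualPair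
open Literature.NumberTheory.GelbartRogawski1991 Literature.NumberTheory.GelbartRogawski1991.UnitaryDualPair
open Literature.Analysis.SegalBargmann
open HodgeCM HodgeCM.Model HodgeCM.Adelic
open HodgeCM.PerL34.Fock HodgeCM.PerL34.Fock.PrintDict
open NumberField.SeesawArchTorus

namespace HodgeCM.Model.HypCensus

section Pin

variable {L : CMField} {ι₁ : L →+* ℂ} (V : HermSpace3 L ι₁) (S : StubTree.SeesawDatum L)
variable
  (hGR : (cmSplittingDatum (L : Type) finProdFinEquiv (frameD V) (frameD_real V) (frameD_ne V) (dW S) (dW_real S) (dW_ne S)).CompatibleSplitting)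
  (η : CMAdelic (L : Type) (frameD V) × CMAdelic (L : Type) (dW S) →* ℂˣ)
  (hη : ∀ γU ∈ CMRat (L : Type) (frameD V), ∀ γ ∈ CMRat (L : Type) (dW S), η (γU, γ) = 1)
  (hηc : Continuous fun p => ((η p : ℂˣ) : ℂ))
  (τ : L →+* ℂ) (T : GL (Fin 3) ℂ)
  (hT : formCongr (starRingEnd ℂ) T (V.Hm.map τ) = Literature.Geometry.ComplexHyperbolic.BallModel.J)
variable (datum : ∀ b : InfinitePlace (L : Type),
  PlaceDatum (L : Type) (frameD V) (frameD_real V) (dW S) (dW_real S) ι₁ (cmPlacesEquiv (L : Type) b))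
variable (m₁ m₂ : InfinitePlace (L : Type) → ℤ)
variable (hW : (∀ j, 0 < (ι₁ ((dW S) j)).re) ∨ ∀ j, (ι₁ ((dW S) j)).re < 0)

/-- **the torus character of the pin `(V, S)`** under the sign fact `hW` (the other three sign facts READ OFF `HermSpace3` / `M = 2`). -/
abbrev pinTorusChar : SeesawArchTorus (L : Type) →* Circle :=
  torusChar (L : Type) (frameD V) (frameD_real V) (frameD_ne V) (dW S) (dW_real S) (dW_ne S) hGR ι₁ (frameD_sign_ι₁' V) hW
    (frameD_sign_of_ne V) (fun τ' _ => signs_fin_two fun j => re_apply_ne_zero_of_complexConj_eq (L : Type) τ' (dW_real S j) (dW_ne S j))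

/-- the archimedean torus element behind a printed torus point: `u_t = placesEquiv⁻¹ (placesCoord t)`. -/
abbrev archOf (t : (printPlaces (InfinitePlace (L : Type)) (kindOf (L : Type) (frameD V) (frameD_real V) (dW S) (dW_real S) ι₁ datum)
      (lamOf (L : Type) (frameD V) (frameD_real V) (dW S) (dW_real S) ι₁ datum)
      (lamOf_ne_zero (L : Type) (frameD V) (frameD_real V) (dW S) (dW_real S) ι₁ datum)
      (pinnedVacs (kindOf (L : Type) (frameD V) (frameD_real V) (dW S) (dW_real S) ι₁ datum) m₁ m₂)).Tg) :
    SeesawArchTorus (L : Type) :=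
  (placesEquiv (L : Type)).symm (placesCoord (InfinitePlace (L : Type)) _ _ _ _ t)

/-- the chart pair `(1, eW (jT₁₂ (ι u)))` IS the archimedean pair element `archProdHom (1, diag u)` (#25). -/
theorem pair_cmAdelicEquiv_jT₁₂_toAdeles (u : SeesawArchTorus (L : Type)) :
    ((1 : CMAdelic (L : Type) (frameD V)),
      (cmAdelicEquiv (L : Type) 2 (Matrix.diagonal (dW S)) (S.jT₁₂ (toAdeles (L : Type) u)) : CMAdelic (L : Type) (dW S))) =
      archProdHom (↥(maximalRealSubfield L)) (L : Type) (IsCMField.complexConj L) 3 2 (Matrix.diagonal (frameD V))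
        (Matrix.diagonal (dW S))
        ((1 : UnitaryGroup.arch (↥(maximalRealSubfield L)) (L : Type) (IsCMField.complexConj L) 3 (Matrix.diagonal (frameD V))),
          archDiag (L : Type) (dW S) u) :=
  Prod.ext (map_one (archToAdelic (↥(maximalRealSubfield L)) (L : Type) (IsCMField.complexConj L) 3
    (Matrix.diagonal (frameD V)))).symm (cmAdelicEquiv_jT₁₂_toAdeles S u)

/-- **(J-T12) at `φ₀`, VALUE currency at the chart point**: `ρ_η(1, eW (jT₁₂ (ι u))) (ins f φ₀) = (η · χ_T(u) · ∏ d(u)) • ins f φ₀`. -/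
theorem cmPairRepTwist_jT₁₂_ins_vacuum
    (d : {v : InfinitePlace ↥(maximalRealSubfield L) // v.IsReal} → SeesawArchTorus (L : Type) → ℂ)
    (hd₁ : ∀ w u, (datum ((cmPlacesEquiv (L : Type)).symm w)).kind ≠ .iota → d w u = 1)
    (hdι : ∀ w u, (datum ((cmPlacesEquiv (L : Type)).symm w)).kind = .iota →
      linSubst (star ((reindexUnitary (pairFrame (PosIdx (cmXV (L : Type) (frameD V) (frameD_real V) ι₁ w))
        (NegIdx (cmXV (L : Type) (frameD V) (frameD_real V) ι₁ w)) (PosIdx (cmXW (L : Type) (frameD V) (dW S) (dW_real S) ι₁ w))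
        (NegIdx (cmXW (L : Type) (frameD V) (dW S) (dW_real S) ι₁ w)) finProdFinEquiv (cmEpsV (L : Type) (frameD V) (frameD_real V) ι₁ w)
        (cmEpsW (L : Type) (frameD V) (dW S) (dW_real S) ι₁ w))
        (dualPairι (torusPlaceLetter (L : Type) (frameD V) (frameD_real V) (dW S) (dW_real S) ι₁ w u)) :
          Matrix.unitaryGroup (Fin 6) ℂ) : Matrix (Fin 6) (Fin 6) ℂ))
        (placePoly (L : Type) (frameD V) (frameD_real V) (dW S) (dW_real S) ι₁ datum m₁ m₂
          (fun b => ((printPlaces (InfinitePlace (L : Type)) (kindOf (L : Type) (frameD V) (frameD_real V) (dW S) (dW_real S) ι₁ datum)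
            (lamOf (L : Type) (frameD V) (frameD_real V) (dW S) (dW_real S) ι₁ datum)
            (lamOf_ne_zero (L : Type) (frameD V) (frameD_real V) (dW S) (dW_real S) ι₁ datum)
            (pinnedVacs (kindOf (L : Type) (frameD V) (frameD_real V) (dW S) (dW_real S) ι₁ datum) m₁ m₂)).loc b).φ) w) =
      d w u • placePoly (L : Type) (frameD V) (frameD_real V) (dW S) (dW_real S) ι₁ datum m₁ m₂
          (fun b => ((printPlaces (InfinitePlace (L : Type)) (kindOf (L : Type) (frameD V) (frameD_real V) (dW S) (dW_real S) ι₁ datum)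
            (lamOf (L : Type) (frameD V) (frameD_real V) (dW S) (dW_real S) ι₁ datum)
            (lamOf_ne_zero (L : Type) (frameD V) (frameD_real V) (dW S) (dW_real S) ι₁ datum)
            (pinnedVacs (kindOf (L : Type) (frameD V) (frameD_real V) (dW S) (dW_real S) ι₁ datum) m₁ m₂)).loc b).φ) w)
    (u : SeesawArchTorus (L : Type)) (f : FinSB ↥(maximalRealSubfield L) (Fin 6)) :
    cmPairRepTwist (L : Type) finProdFinEquiv (frameD V) (frameD_real V) (frameD_ne V) (dW S) (dW_real S) (dW_ne S) hGR η
        ((1 : CMAdelic (L : Type) (frameD V)),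
          (cmAdelicEquiv (L : Type) 2 (Matrix.diagonal (dW S)) (S.jT₁₂ (toAdeles (L : Type) u)) : CMAdelic (L : Type) (dW S)))
        (ins (L : Type) (frameD V) (frameD_real V) (frameD_ne V) (dW S) (dW_real S) (dW_ne S) ι₁ datum m₁ m₂ f
          (printPlaces (InfinitePlace (L : Type)) (kindOf (L : Type) (frameD V) (frameD_real V) (dW S) (dW_real S) ι₁ datum)
            (lamOf (L : Type) (frameD V) (frameD_real V) (dW S) (dW_real S) ι₁ datum)
            (lamOf_ne_zero (L : Type) (frameD V) (frameD_real V) (dW S) (dW_real S) ι₁ datum)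
            (pinnedVacs (kindOf (L : Type) (frameD V) (frameD_real V) (dW S) (dW_real S) ι₁ datum) m₁ m₂)).φ₀) =
      (((η (archProdHom (↥(maximalRealSubfield L)) (L : Type) (IsCMField.complexConj L) 3 2 (Matrix.diagonal (frameD V))
            (Matrix.diagonal (dW S))
            ((1 : UnitaryGroup.arch (↥(maximalRealSubfield L)) (L : Type) (IsCMField.complexConj L) 3 (Matrix.diagonal (frameD V))),
              archDiag (L : Type) (dW S) u)) : ℂˣ) : ℂ) *
          ((pinTorusChar V S hGR hW u : Circle) : ℂ) * ∏ w, d w u) •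
        ins (L : Type) (frameD V) (frameD_real V) (frameD_ne V) (dW S) (dW_real S) (dW_ne S) ι₁ datum m₁ m₂ f
          (printPlaces (InfinitePlace (L : Type)) (kindOf (L : Type) (frameD V) (frameD_real V) (dW S) (dW_real S) ι₁ datum)
            (lamOf (L : Type) (frameD V) (frameD_real V) (dW S) (dW_real S) ι₁ datum)
            (lamOf_ne_zero (L : Type) (frameD V) (frameD_real V) (dW S) (dW_real S) ι₁ datum)
            (pinnedVacs (kindOf (L : Type) (frameD V) (frameD_real V) (dW S) (dW_real S) ι₁ datum) m₁ m₂)).φ₀ :=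
  (congrArg (fun p => cmPairRepTwist (L : Type) finProdFinEquiv (frameD V) (frameD_real V) (frameD_ne V) (dW S) (dW_real S)
      (dW_ne S) hGR η p (ins (L : Type) (frameD V) (frameD_real V) (frameD_ne V) (dW S) (dW_real S) (dW_ne S) ι₁ datum m₁ m₂ f
        (printPlaces (InfinitePlace (L : Type)) (kindOf (L : Type) (frameD V) (frameD_real V) (dW S) (dW_real S) ι₁ datum)
          (lamOf (L : Type) (frameD V) (frameD_real V) (dW S) (dW_real S) ι₁ datum)
          (lamOf_ne_zero (L : Type) (frameD V) (frameD_real V) (dW S) (dW_real S) ι₁ datum)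
          (pinnedVacs (kindOf (L : Type) (frameD V) (frameD_real V) (dW S) (dW_real S) ι₁ datum) m₁ m₂)).φ₀))
      (pair_cmAdelicEquiv_jT₁₂_toAdeles V S u)).trans
    (cmPairRepTwist_torus_ins_vacuum (L : Type) (frameD V) (frameD_real V) (frameD_ne V) (dW S) (dW_real S) (dW_ne S) hGR ι₁
      (frameD_sign_ι₁' V) hW (frameD_sign_of_ne V)
      (fun τ' _ => signs_fin_two fun j => re_apply_ne_zero_of_complexConj_eq (L : Type) τ' (dW_real S j) (dW_ne S j)) η datum
      m₁ m₂ u f (fun w => d w u) (fun w hw => hd₁ w u hw) (fun w hw => hdι w u hw))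

/-- … and on every scalar multiple `a • φ₀` of the printed vacuum (linearity). -/
theorem cmPairRepTwist_jT₁₂_ins_smul_vacuum
    (d : {v : InfinitePlace ↥(maximalRealSubfield L) // v.IsReal} → SeesawArchTorus (L : Type) → ℂ)
    (hd₁ : ∀ w u, (datum ((cmPlacesEquiv (L : Type)).symm w)).kind ≠ .iota → d w u = 1)
    (hdι : ∀ w u, (datum ((cmPlacesEquiv (L : Type)).symm w)).kind = .iota →
      linSubst (star ((reindexUnitary (pairFrame (PosIdx (cmXV (L : Type) (frameD V) (frameD_real V) ι₁ w))
        (NegIdx (cmXV (L : Type) (frameD V) (frameD_real V) ι₁ w)) (PosIdx (cmXW (L : Type) (frameD V) (dW S) (dW_real S) ι₁ w))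
        (NegIdx (cmXW (L : Type) (frameD V) (dW S) (dW_real S) ι₁ w)) finProdFinEquiv (cmEpsV (L : Type) (frameD V) (frameD_real V) ι₁ w)
        (cmEpsW (L : Type) (frameD V) (dW S) (dW_real S) ι₁ w))
        (dualPairι (torusPlaceLetter (L : Type) (frameD V) (frameD_real V) (dW S) (dW_real S) ι₁ w u)) :
          Matrix.unitaryGroup (Fin 6) ℂ) : Matrix (Fin 6) (Fin 6) ℂ))
        (placePoly (L : Type) (frameD V) (frameD_real V) (dW S) (dW_real S) ι₁ datum m₁ m₂
          (fun b => ((printPlaces (InfinitePlace (L : Type)) (kindOf (L : Type) (frameD V) (frameD_real V) (dW S) (dW_real S) ι₁ datum)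
            (lamOf (L : Type) (frameD V) (frameD_real V) (dW S) (dW_real S) ι₁ datum)
            (lamOf_ne_zero (L : Type) (frameD V) (frameD_real V) (dW S) (dW_real S) ι₁ datum)
            (pinnedVacs (kindOf (L : Type) (frameD V) (frameD_real V) (dW S) (dW_real S) ι₁ datum) m₁ m₂)).loc b).φ) w) =
      d w u • placePoly (L : Type) (frameD V) (frameD_real V) (dW S) (dW_real S) ι₁ datum m₁ m₂
          (fun b => ((printPlaces (InfinitePlace (L : Type)) (kindOf (L : Type) (frameD V) (frameD_real V) (dW S) (dW_real S) ι₁ datum)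
            (lamOf (L : Type) (frameD V) (frameD_real V) (dW S) (dW_real S) ι₁ datum)
            (lamOf_ne_zero (L : Type) (frameD V) (frameD_real V) (dW S) (dW_real S) ι₁ datum)
            (pinnedVacs (kindOf (L : Type) (frameD V) (frameD_real V) (dW S) (dW_real S) ι₁ datum) m₁ m₂)).loc b).φ) w)
    (u : SeesawArchTorus (L : Type)) (f : FinSB ↥(maximalRealSubfield L) (Fin 6)) (a : ℂ) :
    cmPairRepTwist (L : Type) finProdFinEquiv (frameD V) (frameD_real V) (frameD_ne V) (dW S) (dW_real S) (dW_ne S) hGR η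
        ((1 : CMAdelic (L : Type) (frameD V)),
          (cmAdelicEquiv (L : Type) 2 (Matrix.diagonal (dW S)) (S.jT₁₂ (toAdeles (L : Type) u)) : CMAdelic (L : Type) (dW S)))
        (ins (L : Type) (frameD V) (frameD_real V) (frameD_ne V) (dW S) (dW_real S) (dW_ne S) ι₁ datum m₁ m₂ f
          (a • (printPlaces (InfinitePlace (L : Type)) (kindOf (L : Type) (frameD V) (frameD_real V) (dW S) (dW_real S) ι₁ datum)
            (lamOf (L : Type) (frameD V) (frameD_real V) (dW S) (dW_real S) ι₁ datum)
            (lamOf_ne_zero (L : Type) (frameD V) (frameD_real V) (dW S) (dW_real S) ι₁ datum)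
            (pinnedVacs (kindOf (L : Type) (frameD V) (frameD_real V) (dW S) (dW_real S) ι₁ datum) m₁ m₂)).φ₀)) =
      (((η (archProdHom (↥(maximalRealSubfield L)) (L : Type) (IsCMField.complexConj L) 3 2 (Matrix.diagonal (frameD V))
            (Matrix.diagonal (dW S))
            ((1 : UnitaryGroup.arch (↥(maximalRealSubfield L)) (L : Type) (IsCMField.complexConj L) 3 (Matrix.diagonal (frameD V))),
              archDiag (L : Type) (dW S) u)) : ℂˣ) : ℂ) *
          ((pinTorusChar V S hGR hW u : Circle) : ℂ) * ∏ w, d w u) •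
        ins (L : Type) (frameD V) (frameD_real V) (frameD_ne V) (dW S) (dW_real S) (dW_ne S) ι₁ datum m₁ m₂ f
          (a • (printPlaces (InfinitePlace (L : Type)) (kindOf (L : Type) (frameD V) (frameD_real V) (dW S) (dW_real S) ι₁ datum)
            (lamOf (L : Type) (frameD V) (frameD_real V) (dW S) (dW_real S) ι₁ datum)
            (lamOf_ne_zero (L : Type) (frameD V) (frameD_real V) (dW S) (dW_real S) ι₁ datum)
            (pinnedVacs (kindOf (L : Type) (frameD V) (frameD_real V) (dW S) (dW_real S) ι₁ datum) m₁ m₂)).φ₀) := by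
  rw [map_smul, map_smul, cmPairRepTwist_jT₁₂_ins_vacuum V S hGR η datum m₁ m₂ hW d hd₁ hdι u f, smul_comm]

/-- **`ω(ι_T t)` on the inserted printed vacuum, at the W pin of record**:
`= (η(1,(diag u_t)_𝔸) · χ_T(u_t) · ∏_{ι₁} d(u_t)) • ins f φ₀`, given the `ι₁` det-line eigen-equations `hdι` (`OmgInsIota`). -/
theorem omgW_ins_vacuum_wmInputCM₂g
    (d : {v : InfinitePlace ↥(maximalRealSubfield L) // v.IsReal} → SeesawArchTorus (L : Type) → ℂ)
    (hd₁ : ∀ w u, (datum ((cmPlacesEquiv (L : Type)).symm w)).kind ≠ .iota → d w u = 1)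
    (hdι : ∀ w u, (datum ((cmPlacesEquiv (L : Type)).symm w)).kind = .iota →
      linSubst (star ((reindexUnitary (pairFrame (PosIdx (cmXV (L : Type) (frameD V) (frameD_real V) ι₁ w))
        (NegIdx (cmXV (L : Type) (frameD V) (frameD_real V) ι₁ w)) (PosIdx (cmXW (L : Type) (frameD V) (dW S) (dW_real S) ι₁ w))
        (NegIdx (cmXW (L : Type) (frameD V) (dW S) (dW_real S) ι₁ w)) finProdFinEquiv (cmEpsV (L : Type) (frameD V) (frameD_real V) ι₁ w)
        (cmEpsW (L : Type) (frameD V) (dW S) (dW_real S) ι₁ w))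
        (dualPairι (torusPlaceLetter (L : Type) (frameD V) (frameD_real V) (dW S) (dW_real S) ι₁ w u)) :
          Matrix.unitaryGroup (Fin 6) ℂ) : Matrix (Fin 6) (Fin 6) ℂ))
        (placePoly (L : Type) (frameD V) (frameD_real V) (dW S) (dW_real S) ι₁ datum m₁ m₂
          (fun b => ((printPlaces (InfinitePlace (L : Type)) (kindOf (L : Type) (frameD V) (frameD_real V) (dW S) (dW_real S) ι₁ datum)
            (lamOf (L : Type) (frameD V) (frameD_real V) (dW S) (dW_real S) ι₁ datum)
            (lamOf_ne_zero (L : Type) (frameD V) (frameD_real V) (dW S) (dW_real S) ι₁ datum)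
            (pinnedVacs (kindOf (L : Type) (frameD V) (frameD_real V) (dW S) (dW_real S) ι₁ datum) m₁ m₂)).loc b).φ) w) =
      d w u • placePoly (L : Type) (frameD V) (frameD_real V) (dW S) (dW_real S) ι₁ datum m₁ m₂
          (fun b => ((printPlaces (InfinitePlace (L : Type)) (kindOf (L : Type) (frameD V) (frameD_real V) (dW S) (dW_real S) ι₁ datum)
            (lamOf (L : Type) (frameD V) (frameD_real V) (dW S) (dW_real S) ι₁ datum)
            (lamOf_ne_zero (L : Type) (frameD V) (frameD_real V) (dW S) (dW_real S) ι₁ datum)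
            (pinnedVacs (kindOf (L : Type) (frameD V) (frameD_real V) (dW S) (dW_real S) ι₁ datum) m₁ m₂)).loc b).φ) w)
    (f : FinSB ↥(maximalRealSubfield L) (Fin 6))
    (t : (printPlaces (InfinitePlace (L : Type)) (kindOf (L : Type) (frameD V) (frameD_real V) (dW S) (dW_real S) ι₁ datum)
      (lamOf (L : Type) (frameD V) (frameD_real V) (dW S) (dW_real S) ι₁ datum)
      (lamOf_ne_zero (L : Type) (frameD V) (frameD_real V) (dW S) (dW_real S) ι₁ datum)
      (pinnedVacs (kindOf (L : Type) (frameD V) (frameD_real V) (dW S) (dW_real S) ι₁ datum) m₁ m₂)).Tg) :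
    omgW (wmInputCM₂g V S hGR η hη hηc τ T hT)
        (printedTorusHom (kindOf (L : Type) (frameD V) (frameD_real V) (dW S) (dW_real S) ι₁ datum)
          (lamOf (L : Type) (frameD V) (frameD_real V) (dW S) (dW_real S) ι₁ datum)
          (lamOf_ne_zero (L : Type) (frameD V) (frameD_real V) (dW S) (dW_real S) ι₁ datum)
          (S.jT₁₂.toMonoidHom.comp (toAdeles (L : Type)))
          (pinnedVacs (kindOf (L : Type) (frameD V) (frameD_real V) (dW S) (dW_real S) ι₁ datum) m₁ m₂) t)
        (ins (L : Type) (frameD V) (frameD_real V) (frameD_ne V) (dW S) (dW_real S) (dW_ne S) ι₁ datum m₁ m₂ f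
          (printPlaces (InfinitePlace (L : Type)) _ _ _ _).φ₀) =
      (((η (archProdHom (↥(maximalRealSubfield L)) (L : Type) (IsCMField.complexConj L) 3 2 (Matrix.diagonal (frameD V))
            (Matrix.diagonal (dW S))
            ((1 : UnitaryGroup.arch (↥(maximalRealSubfield L)) (L : Type) (IsCMField.complexConj L) 3 (Matrix.diagonal (frameD V))),
              archDiag (L : Type) (dW S) (archOf V S datum m₁ m₂ t))) : ℂˣ) : ℂ) *
          ((pinTorusChar V S hGR hW (archOf V S datum m₁ m₂ t) : Circle) : ℂ) * ∏ w, d w (archOf V S datum m₁ m₂ t)) •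
        ins (L : Type) (frameD V) (frameD_real V) (frameD_ne V) (dW S) (dW_real S) (dW_ne S) ι₁ datum m₁ m₂ f
          (printPlaces (InfinitePlace (L : Type)) _ _ _ _).φ₀ := by
  dsimp only [omgW]
  rw [wmInputCM₂g_ρ_eq_of V S hGR η hη hηc τ T hT hW, printedTorusHom_apply]
  exact cmPairRepTwist_jT₁₂_ins_vacuum V S hGR η datum m₁ m₂ hW d hd₁ hdι (archOf V S datum m₁ m₂ t) f

/-- **the census field `omg_ins` AT THE PRINTED VACUUM from ONE scalar identity on the torus** ((J-μ)/(R3)): if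
`η(1,(diag u_t)_𝔸) · χ_T(u_t) · ∏ d(u_t) = (w t)⁻¹` for every printed torus point `t`, then `ω(ι_T t)(ins f φ₀) = ins f (ω_T t φ₀)`. -/
theorem omgW_ins_vacuum_eq_of_weight
    (d : {v : InfinitePlace ↥(maximalRealSubfield L) // v.IsReal} → SeesawArchTorus (L : Type) → ℂ)
    (hd₁ : ∀ w u, (datum ((cmPlacesEquiv (L : Type)).symm w)).kind ≠ .iota → d w u = 1)
    (hdι : ∀ w u, (datum ((cmPlacesEquiv (L : Type)).symm w)).kind = .iota →
      linSubst (star ((reindexUnitary (pairFrame (PosIdx (cmXV (L : Type) (frameD V) (frameD_real V) ι₁ w))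
        (NegIdx (cmXV (L : Type) (frameD V) (frameD_real V) ι₁ w)) (PosIdx (cmXW (L : Type) (frameD V) (dW S) (dW_real S) ι₁ w))
        (NegIdx (cmXW (L : Type) (frameD V) (dW S) (dW_real S) ι₁ w)) finProdFinEquiv (cmEpsV (L : Type) (frameD V) (frameD_real V) ι₁ w)
        (cmEpsW (L : Type) (frameD V) (dW S) (dW_real S) ι₁ w))
        (dualPairι (torusPlaceLetter (L : Type) (frameD V) (frameD_real V) (dW S) (dW_real S) ι₁ w u)) :
          Matrix.unitaryGroup (Fin 6) ℂ) : Matrix (Fin 6) (Fin 6) ℂ))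
        (placePoly (L : Type) (frameD V) (frameD_real V) (dW S) (dW_real S) ι₁ datum m₁ m₂
          (fun b => ((printPlaces (InfinitePlace (L : Type)) (kindOf (L : Type) (frameD V) (frameD_real V) (dW S) (dW_real S) ι₁ datum)
            (lamOf (L : Type) (frameD V) (frameD_real V) (dW S) (dW_real S) ι₁ datum)
            (lamOf_ne_zero (L : Type) (frameD V) (frameD_real V) (dW S) (dW_real S) ι₁ datum)
            (pinnedVacs (kindOf (L : Type) (frameD V) (frameD_real V) (dW S) (dW_real S) ι₁ datum) m₁ m₂)).loc b).φ) w) =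
      d w u • placePoly (L : Type) (frameD V) (frameD_real V) (dW S) (dW_real S) ι₁ datum m₁ m₂
          (fun b => ((printPlaces (InfinitePlace (L : Type)) (kindOf (L : Type) (frameD V) (frameD_real V) (dW S) (dW_real S) ι₁ datum)
            (lamOf (L : Type) (frameD V) (frameD_real V) (dW S) (dW_real S) ι₁ datum)
            (lamOf_ne_zero (L : Type) (frameD V) (frameD_real V) (dW S) (dW_real S) ι₁ datum)
            (pinnedVacs (kindOf (L : Type) (frameD V) (frameD_real V) (dW S) (dW_real S) ι₁ datum) m₁ m₂)).loc b).φ) w)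
    (hμ : ∀ t : (printPlaces (InfinitePlace (L : Type)) (kindOf (L : Type) (frameD V) (frameD_real V) (dW S) (dW_real S) ι₁ datum)
        (lamOf (L : Type) (frameD V) (frameD_real V) (dW S) (dW_real S) ι₁ datum)
        (lamOf_ne_zero (L : Type) (frameD V) (frameD_real V) (dW S) (dW_real S) ι₁ datum)
        (pinnedVacs (kindOf (L : Type) (frameD V) (frameD_real V) (dW S) (dW_real S) ι₁ datum) m₁ m₂)).Tg,
      (((η (archProdHom (↥(maximalRealSubfield L)) (L : Type) (IsCMField.complexConj L) 3 2 (Matrix.diagonal (frameD V))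
            (Matrix.diagonal (dW S))
            ((1 : UnitaryGroup.arch (↥(maximalRealSubfield L)) (L : Type) (IsCMField.complexConj L) 3 (Matrix.diagonal (frameD V))),
              archDiag (L : Type) (dW S) (archOf V S datum m₁ m₂ t))) : ℂˣ) : ℂ) *
          ((pinTorusChar V S hGR hW (archOf V S datum m₁ m₂ t) : Circle) : ℂ) * ∏ w, d w (archOf V S datum m₁ m₂ t)) =
        (printPlacesW (InfinitePlace (L : Type)) (kindOf (L : Type) (frameD V) (frameD_real V) (dW S) (dW_real S) ι₁ datum)
          (lamOf (L : Type) (frameD V) (frameD_real V) (dW S) (dW_real S) ι₁ datum)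
          (lamOf_ne_zero (L : Type) (frameD V) (frameD_real V) (dW S) (dW_real S) ι₁ datum)
          (pinnedVacs (kindOf (L : Type) (frameD V) (frameD_real V) (dW S) (dW_real S) ι₁ datum) m₁ m₂) t)⁻¹)
    (f : FinSB ↥(maximalRealSubfield L) (Fin 6))
    (t : (printPlaces (InfinitePlace (L : Type)) (kindOf (L : Type) (frameD V) (frameD_real V) (dW S) (dW_real S) ι₁ datum)
      (lamOf (L : Type) (frameD V) (frameD_real V) (dW S) (dW_real S) ι₁ datum)
      (lamOf_ne_zero (L : Type) (frameD V) (frameD_real V) (dW S) (dW_real S) ι₁ datum)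
      (pinnedVacs (kindOf (L : Type) (frameD V) (frameD_real V) (dW S) (dW_real S) ι₁ datum) m₁ m₂)).Tg) :
    omgW (wmInputCM₂g V S hGR η hη hηc τ T hT)
        (printedTorusHom (kindOf (L : Type) (frameD V) (frameD_real V) (dW S) (dW_real S) ι₁ datum)
          (lamOf (L : Type) (frameD V) (frameD_real V) (dW S) (dW_real S) ι₁ datum)
          (lamOf_ne_zero (L : Type) (frameD V) (frameD_real V) (dW S) (dW_real S) ι₁ datum)
          (S.jT₁₂.toMonoidHom.comp (toAdeles (L : Type)))
          (pinnedVacs (kindOf (L : Type) (frameD V) (frameD_real V) (dW S) (dW_real S) ι₁ datum) m₁ m₂) t)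
        (ins (L : Type) (frameD V) (frameD_real V) (frameD_ne V) (dW S) (dW_real S) (dW_ne S) ι₁ datum m₁ m₂ f
          (printPlaces (InfinitePlace (L : Type)) _ _ _ _).φ₀) =
      ins (L : Type) (frameD V) (frameD_real V) (frameD_ne V) (dW S) (dW_real S) (dW_ne S) ι₁ datum m₁ m₂ f
        ((printPlaces (InfinitePlace (L : Type)) (kindOf (L : Type) (frameD V) (frameD_real V) (dW S) (dW_real S) ι₁ datum)
          (lamOf (L : Type) (frameD V) (frameD_real V) (dW S) (dW_real S) ι₁ datum)
          (lamOf_ne_zero (L : Type) (frameD V) (frameD_real V) (dW S) (dW_real S) ι₁ datum)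
          (pinnedVacs (kindOf (L : Type) (frameD V) (frameD_real V) (dW S) (dW_real S) ι₁ datum) m₁ m₂)).ωT t
          (printPlaces (InfinitePlace (L : Type)) _ _ _ _).φ₀) := by
  rw [omgW_ins_vacuum_wmInputCM₂g V S hGR η hη hηc τ T hT datum m₁ m₂ hW d hd₁ hdι f t, hμ t, printPlaces_ωT_φ₀, map_smul]

/-- … hence also on every scalar multiple of the printed vacuum (model1's variant `∀ f t (a : ℂ), … (a • φ₀) …` of the re-cut field,
which is what `ArchCOrbit.covariant` rewrites with `a := w t`). -/
theorem omgW_ins_smul_vacuum_eq_of_weight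
    (d : {v : InfinitePlace ↥(maximalRealSubfield L) // v.IsReal} → SeesawArchTorus (L : Type) → ℂ)
    (hd₁ : ∀ w u, (datum ((cmPlacesEquiv (L : Type)).symm w)).kind ≠ .iota → d w u = 1)
    (hdι : ∀ w u, (datum ((cmPlacesEquiv (L : Type)).symm w)).kind = .iota →
      linSubst (star ((reindexUnitary (pairFrame (PosIdx (cmXV (L : Type) (frameD V) (frameD_real V) ι₁ w))
        (NegIdx (cmXV (L : Type) (frameD V) (frameD_real V) ι₁ w)) (PosIdx (cmXW (L : Type) (frameD V) (dW S) (dW_real S) ι₁ w))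
        (NegIdx (cmXW (L : Type) (frameD V) (dW S) (dW_real S) ι₁ w)) finProdFinEquiv (cmEpsV (L : Type) (frameD V) (frameD_real V) ι₁ w)
        (cmEpsW (L : Type) (frameD V) (dW S) (dW_real S) ι₁ w))
        (dualPairι (torusPlaceLetter (L : Type) (frameD V) (frameD_real V) (dW S) (dW_real S) ι₁ w u)) :
          Matrix.unitaryGroup (Fin 6) ℂ) : Matrix (Fin 6) (Fin 6) ℂ))
        (placePoly (L : Type) (frameD V) (frameD_real V) (dW S) (dW_real S) ι₁ datum m₁ m₂
          (fun b => ((printPlaces (InfinitePlace (L : Type)) (kindOf (L : Type) (frameD V) (frameD_real V) (dW S) (dW_real S) ι₁ datum)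
            (lamOf (L : Type) (frameD V) (frameD_real V) (dW S) (dW_real S) ι₁ datum)
            (lamOf_ne_zero (L : Type) (frameD V) (frameD_real V) (dW S) (dW_real S) ι₁ datum)
            (pinnedVacs (kindOf (L : Type) (frameD V) (frameD_real V) (dW S) (dW_real S) ι₁ datum) m₁ m₂)).loc b).φ) w) =
      d w u • placePoly (L : Type) (frameD V) (frameD_real V) (dW S) (dW_real S) ι₁ datum m₁ m₂
          (fun b => ((printPlaces (InfinitePlace (L : Type)) (kindOf (L : Type) (frameD V) (frameD_real V) (dW S) (dW_real S) ι₁ datum)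
            (lamOf (L : Type) (frameD V) (frameD_real V) (dW S) (dW_real S) ι₁ datum)
            (lamOf_ne_zero (L : Type) (frameD V) (frameD_real V) (dW S) (dW_real S) ι₁ datum)
            (pinnedVacs (kindOf (L : Type) (frameD V) (frameD_real V) (dW S) (dW_real S) ι₁ datum) m₁ m₂)).loc b).φ) w)
    (hμ : ∀ t : (printPlaces (InfinitePlace (L : Type)) (kindOf (L : Type) (frameD V) (frameD_real V) (dW S) (dW_real S) ι₁ datum)
        (lamOf (L : Type) (frameD V) (frameD_real V) (dW S) (dW_real S) ι₁ datum)
        (lamOf_ne_zero (L : Type) (frameD V) (frameD_real V) (dW S) (dW_real S) ι₁ datum)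
        (pinnedVacs (kindOf (L : Type) (frameD V) (frameD_real V) (dW S) (dW_real S) ι₁ datum) m₁ m₂)).Tg,
      (((η (archProdHom (↥(maximalRealSubfield L)) (L : Type) (IsCMField.complexConj L) 3 2 (Matrix.diagonal (frameD V))
            (Matrix.diagonal (dW S))
            ((1 : UnitaryGroup.arch (↥(maximalRealSubfield L)) (L : Type) (IsCMField.complexConj L) 3 (Matrix.diagonal (frameD V))),
              archDiag (L : Type) (dW S) (archOf V S datum m₁ m₂ t))) : ℂˣ) : ℂ) *
          ((pinTorusChar V S hGR hW (archOf V S datum m₁ m₂ t) : Circle) : ℂ) * ∏ w, d w (archOf V S datum m₁ m₂ t)) =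
        (printPlacesW (InfinitePlace (L : Type)) (kindOf (L : Type) (frameD V) (frameD_real V) (dW S) (dW_real S) ι₁ datum)
          (lamOf (L : Type) (frameD V) (frameD_real V) (dW S) (dW_real S) ι₁ datum)
          (lamOf_ne_zero (L : Type) (frameD V) (frameD_real V) (dW S) (dW_real S) ι₁ datum)
          (pinnedVacs (kindOf (L : Type) (frameD V) (frameD_real V) (dW S) (dW_real S) ι₁ datum) m₁ m₂) t)⁻¹)
    (f : FinSB ↥(maximalRealSubfield L) (Fin 6))
    (t : (printPlaces (InfinitePlace (L : Type)) (kindOf (L : Type) (frameD V) (frameD_real V) (dW S) (dW_real S) ι₁ datum)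
      (lamOf (L : Type) (frameD V) (frameD_real V) (dW S) (dW_real S) ι₁ datum)
      (lamOf_ne_zero (L : Type) (frameD V) (frameD_real V) (dW S) (dW_real S) ι₁ datum)
      (pinnedVacs (kindOf (L : Type) (frameD V) (frameD_real V) (dW S) (dW_real S) ι₁ datum) m₁ m₂)).Tg) (a : ℂ) :
    omgW (wmInputCM₂g V S hGR η hη hηc τ T hT)
        (printedTorusHom (kindOf (L : Type) (frameD V) (frameD_real V) (dW S) (dW_real S) ι₁ datum)
          (lamOf (L : Type) (frameD V) (frameD_real V) (dW S) (dW_real S) ι₁ datum)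
          (lamOf_ne_zero (L : Type) (frameD V) (frameD_real V) (dW S) (dW_real S) ι₁ datum)
          (S.jT₁₂.toMonoidHom.comp (toAdeles (L : Type)))
          (pinnedVacs (kindOf (L : Type) (frameD V) (frameD_real V) (dW S) (dW_real S) ι₁ datum) m₁ m₂) t)
        (ins (L : Type) (frameD V) (frameD_real V) (frameD_ne V) (dW S) (dW_real S) (dW_ne S) ι₁ datum m₁ m₂ f
          (a • (printPlaces (InfinitePlace (L : Type)) _ _ _ _).φ₀)) =
      ins (L : Type) (frameD V) (frameD_real V) (frameD_ne V) (dW S) (dW_real S) (dW_ne S) ι₁ datum m₁ m₂ f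
        ((printPlaces (InfinitePlace (L : Type)) (kindOf (L : Type) (frameD V) (frameD_real V) (dW S) (dW_real S) ι₁ datum)
          (lamOf (L : Type) (frameD V) (frameD_real V) (dW S) (dW_real S) ι₁ datum)
          (lamOf_ne_zero (L : Type) (frameD V) (frameD_real V) (dW S) (dW_real S) ι₁ datum)
          (pinnedVacs (kindOf (L : Type) (frameD V) (frameD_real V) (dW S) (dW_real S) ι₁ datum) m₁ m₂)).ωT t
          (a • (printPlaces (InfinitePlace (L : Type)) _ _ _ _).φ₀)) := by
  dsimp only [omgW]
  rw [wmInputCM₂g_ρ_eq_of V S hGR η hη hηc τ T hT hW, printedTorusHom_apply]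
  refine (cmPairRepTwist_jT₁₂_ins_smul_vacuum V S hGR η datum m₁ m₂ hW d hd₁ hdι (archOf V S datum m₁ m₂ t) f a).trans ?_
  rw [hμ t, map_smul, map_smul, map_smul, printPlaces_ωT_φ₀, map_smul]
  exact smul_comm _ _ _

end Pin

end HodgeCM.Model.HypCensus

end
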